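import Mathlib.Tactic.Linarith
import Mathlib.Tactic.Ring
import Mathlib.Tactic.Positivity
import Mathlib.Tactic.Zify
import Mathlib.Algebra.Group.Nat.Even
import HarnessLib

/-!
# A-level classification of near-extremal coset-size vectors, `|A| ≡ 2 (mod 3)`

ω-census, family (b3).  Framing: lottery ticket; floor = certified bounds/negative ranges.

The counting skeleton of the dihedral-like argument (`DihedralTPPUpperBound.lean`): integers `0 ≤ Aᵢ ≤ N` with
Newton's inequalities `3A₀A₂ ≤ A₁²`, `3A₁A₃ ≤ A₂²` have `3(A₀+A₁+A₂+A₃) ≤ 8N`.  Here we classify the vectors with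
`3(A₀+A₁+A₂+A₃) ≥ 8N − 15` when `N ≡ 2 (mod 3)`, `N` even, `N ≥ 14` (`avec_mod_two`): `A₀, A₃ ≥ 1`,
`A₁, A₂ ≥ N − 2`, `A₁ + A₂ ≥ 2N − 2`, and on the edge `A₂ = N − 2` (resp. `A₁ = N − 2`) the pair `(3A₀, 3A₃)` is one of
`(N−2, N−5), (N+1, N−8), (N+1, N−5)` (resp. mirrored).  The case `N = 14` is a finite check (`avec_fourteen`); for
`N ≥ 20` the proof is by Newton's inequalities, a concavity/chord argument and congruences mod `3`.  The parity lemma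
`no_edge_class` shows that the edge is incompatible with the tiling triangle having even parts.  Consumed by
`DicyclicLawModOne.lean` (`β(Q_{4n}) = 8⌊2n/3⌋` for `n ≡ 1 (mod 3)`).
-/

namespace Summit.MatrixMultiplication.OmegaCensus

/-- The finite check `N = 14` (ranges pre-reduced: `9 ≤ A₁`, `4 ≤ A₂`, `A₃ ≤ 4`). [folklore] -/
theorem avec_fourteen (A₁ A₂ A₀ A₃ : ℕ) (b₁ : A₁ < 15) (b₂ : A₂ < 15) (b₀ : A₀ < 15) (b₃ : A₃ < 5)
    (h9 : 9 ≤ A₁) (h4 : 4 ≤ A₂) (hN₁ : 3 * A₀ * A₂ ≤ A₁ ^ 2) (hN₂ : 3 * A₁ * A₃ ≤ A₂ ^ 2) (h21 : A₂ ≤ A₁)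
    (hV : 97 ≤ 3 * (A₀ + A₁ + A₂ + A₃)) :
    1 ≤ A₀ ∧ 1 ≤ A₃ ∧ 12 ≤ A₂ ∧ (A₁ = 14 ∨ (A₁ = 13 ∧ A₂ = 13)) ∧
      (A₂ = 12 → (3 * A₀ = 12 ∧ 3 * A₃ = 9) ∨ (3 * A₀ = 15 ∧ (3 * A₃ = 6 ∨ 3 * A₃ = 9))) := by
  have key : ((List.range 15).all fun A₁ => (List.range 15).all fun A₂ => (List.range 15).all fun A₀ =>
      (List.range 5).all fun A₃ => decide (9 ≤ A₁ → 4 ≤ A₂ → 3 * A₀ * A₂ ≤ A₁ ^ 2 → 3 * A₁ * A₃ ≤ A₂ ^ 2 →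
        A₂ ≤ A₁ → 97 ≤ 3 * (A₀ + A₁ + A₂ + A₃) →
        (1 ≤ A₀ ∧ 1 ≤ A₃ ∧ 12 ≤ A₂ ∧ (A₁ = 14 ∨ (A₁ = 13 ∧ A₂ = 13)) ∧
          (A₂ = 12 → (3 * A₀ = 12 ∧ 3 * A₃ = 9) ∨ (3 * A₀ = 15 ∧ (3 * A₃ = 6 ∨ 3 * A₃ = 9)))))) = true := by
    decide
  simp only [List.all_eq_true, List.mem_range, decide_eq_true_iff] at key
  exact key A₁ b₁ A₂ b₂ A₀ b₀ A₃ b₃ h9 h4 hN₁ hN₂ h21 hV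

/-- Half of the classification (`A₂ ≤ A₁`). [folklore] -/
theorem avec_mod_two_aux (N A₀ A₁ A₂ A₃ : ℤ) (hA₀ : 0 ≤ A₀) (hA₁ : 0 ≤ A₁) (hA₂ : 0 ≤ A₂) (hA₃ : 0 ≤ A₃)
    (h₀ : A₀ ≤ N) (h₁ : A₁ ≤ N) (h₂ : A₂ ≤ N) (h₃ : A₃ ≤ N)
    (hN₁ : 3 * A₀ * A₂ ≤ A₁ ^ 2) (hN₂ : 3 * A₁ * A₃ ≤ A₂ ^ 2) (h21 : A₂ ≤ A₁) (hmod : N % 3 = 2)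
    (heven : N % 2 = 0) (hN : 14 ≤ N) (hV : 8 * N - 15 ≤ 3 * (A₀ + A₁ + A₂ + A₃)) :
    1 ≤ A₀ ∧ 1 ≤ A₃ ∧ N - 2 ≤ A₂ ∧ (A₁ = N ∨ (A₁ = N - 1 ∧ A₂ = N - 1)) ∧
      (A₂ = N - 2 → (3 * A₀ = N - 2 ∧ 3 * A₃ = N - 5) ∨
        (3 * A₀ = N + 1 ∧ (3 * A₃ = N - 8 ∨ 3 * A₃ = N - 5))) := by
  -- `A₁ > 0`
  rcases eq_or_lt_of_le hA₁ with h1 | hA1pos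
  · exfalso
    have hA2z : A₂ = 0 := le_antisymm (h1 ▸ h21) hA₂
    subst hA2z; rw [← h1] at hV; linarith
  -- `3 A₃ ≤ A₂`
  have h33 : A₁ * (3 * A₃) ≤ A₁ * A₂ :=
    calc A₁ * (3 * A₃) = 3 * A₁ * A₃ := by ring
      _ ≤ A₂ ^ 2 := hN₂
      _ = A₂ * A₂ := by ring
      _ ≤ A₁ * A₂ := mul_le_mul_of_nonneg_right h21 hA₂
  have hA3 : 3 * A₃ ≤ A₂ := le_of_mul_le_mul_left h33 hA1pos
  -- `3 A₀ + 4 A₂ ≤ 5 N`, hence `A₁ ≥ N - 5`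
  have e : N * (5 * N - 3 * A₀ - 4 * A₂) = (N ^ 2 - 3 * A₀ * A₂) + (N - A₂) * (4 * N - 3 * A₀) := by ring
  have hsq1 : A₁ ^ 2 ≤ N ^ 2 := pow_le_pow_left₀ hA₁ h₁ 2
  have hprod0 : 0 ≤ (N - A₂) * (4 * N - 3 * A₀) := mul_nonneg (sub_nonneg.2 h₂) (by linarith)
  have h54 : N * 0 ≤ N * (5 * N - 3 * A₀ - 4 * A₂) := by rw [e, mul_zero]; linarith
  have h54' : 3 * A₀ + 4 * A₂ ≤ 5 * N := by
    have := le_of_mul_le_mul_left h54 (by linarith : (0:ℤ) < N); linarith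
  have hA1ge : N - 5 ≤ A₁ := by linarith
  -- the case `N = 14` by the finite check
  by_cases h14 : N = 14
  · subst h14
    have hA2ge : 4 ≤ A₂ := by linarith
    have hA3le : A₃ ≤ 4 := by linarith
    have hV' : 97 ≤ 3 * (A₀ + A₁ + A₂ + A₃) := by linarith
    lift A₀ to ℕ using hA₀
    lift A₁ to ℕ using hA₁
    lift A₂ to ℕ using hA₂
    lift A₃ to ℕ using hA₃
    have key := avec_fourteen A₁ A₂ A₀ A₃ (by omega) (by omega) (by omega) (by omega) (by omega) (by omega)
      (by exact_mod_cast hN₁) (by exact_mod_cast hN₂) (by exact_mod_cast h21) (by exact_mod_cast hV')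
    omega
  have hN20 : 20 ≤ N := by omega
  -- `j = N - A₁ ≤ 2`
  have hlow : 5 * N - 3 * A₀ - 4 * A₂ ≤ 15 - 3 * (N - A₁) := by linarith
  have hp : (N - A₁) * N ≤ (N - A₂) * (4 * N - 3 * A₀) :=
    mul_le_mul (by linarith) (by linarith) (by linarith) (by linarith)
  have hmain : N ^ 2 - A₁ ^ 2 + (N - A₁) * N ≤ N * (15 - 3 * (N - A₁)) := by
    have := mul_le_mul_of_nonneg_left hlow (by linarith : (0:ℤ) ≤ N)
    linarith
  have hj : A₁ ≥ N - 2 := by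
    by_contra hj
    push Not at hj
    linarith [mul_nonneg (by linarith : (0:ℤ) ≤ N - A₁ - 3) (by linarith : (0:ℤ) ≤ 6 * N - (N - A₁) - 3)]
  -- the three values of `A₁`
  have hcases : A₁ = N - 2 ∨ A₁ = N - 1 ∨ A₁ = N := by omega
  rcases hcases with hA1 | hA1 | hA1
  · -- `A₁ = N - 2` is impossible
    exfalso
    subst hA1
    have hq : (5 * N - 9 - 4 * A₂) * A₂ ≤ (N - 2) ^ 2 :=
      le_trans (mul_le_mul_of_nonneg_right (by linarith) hA₂) hN₁
    linarith [mul_nonneg (by linarith : (0:ℤ) ≤ 4 * A₂ - 2 * N + 9) (sub_nonneg.2 h21),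
      mul_nonneg (sub_nonneg.2 h21) (by linarith : (0:ℤ) ≤ N - 8)]
  · -- `A₁ = N - 1`: then `A₂ = N - 1`
    subst hA1
    have hq : (5 * N - 12 - 4 * A₂) * A₂ ≤ (N - 1) ^ 2 :=
      le_trans (mul_le_mul_of_nonneg_right (by linarith) hA₂) hN₁
    have hA2ge : N - 3 ≤ A₂ := by
      by_contra hc
      push Not at hc
      linarith [mul_nonneg (by linarith : (0:ℤ) ≤ 2 * A₂ - N + 6) (by linarith : (0:ℤ) ≤ N - 4 - A₂),
        mul_nonneg (by linarith : (0:ℤ) ≤ N - 4 - A₂) (by linarith : (0:ℤ) ≤ N - 16)]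
    have hA2cases : A₂ = N - 3 ∨ A₂ = N - 2 ∨ A₂ = N - 1 := by omega
    rcases hA2cases with hA2 | hA2 | hA2
    · exfalso
      subst hA2
      have hup : 3 * A₀ ≤ N + 1 := by
        by_contra hc
        have hc' : N + 2 ≤ 3 * A₀ := by omega
        linarith [mul_le_mul_of_nonneg_right hc' (by linarith : (0:ℤ) ≤ N - 3)]
      have h3A0 : 3 * A₀ = N + 1 := by omega
      have h3A3 : N - 2 ≤ 3 * A₃ := by omega
      linarith [mul_le_mul_of_nonneg_right h3A3 (by linarith : (0:ℤ) ≤ N - 1)]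
    · exfalso
      subst hA2
      have hup : 3 * A₀ ≤ N := by
        by_contra hc
        have hc' : N + 1 ≤ 3 * A₀ := by omega
        linarith [mul_le_mul_of_nonneg_right hc' (by linarith : (0:ℤ) ≤ N - 2)]
      have h3A0 : 3 * A₀ = N - 2 := by omega
      have h3A3 : N - 2 ≤ 3 * A₃ := by omega
      linarith [mul_le_mul_of_nonneg_right h3A3 (by linarith : (0:ℤ) ≤ N - 1)]
    · subst hA2
      have hup : 3 * A₀ ≤ N + 2 := by
        by_contra hc
        have hc' : N + 3 ≤ 3 * A₀ := by omega
        linarith [mul_le_mul_of_nonneg_right hc' (by linarith : (0:ℤ) ≤ N - 1)]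
      have hup3 : 3 * A₃ ≤ N - 1 := by
        by_contra hc
        have hc' : N ≤ 3 * A₃ := by omega
        linarith [mul_le_mul_of_nonneg_left hc' (by linarith : (0:ℤ) ≤ N - 1)]
      refine ⟨by omega, by omega, by omega, Or.inr ⟨rfl, rfl⟩, fun h => by omega⟩
  · -- `A₁ = N` (so `N` is replaced by `A₁` below): then `A₂ ≥ N - 2`, with the edge classes
    subst hA1
    have hV' : 5 * A₁ - 15 ≤ 3 * A₀ + 3 * A₂ + 3 * A₃ := by linarith
    have hsqA : 20 * A₁ ≤ A₁ * A₁ := mul_le_mul_of_nonneg_right hN20 (le_of_lt hA1pos)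
    -- `A₂ ≥ N - 4`
    have hA2ge4 : A₁ - 4 ≤ A₂ := by
      by_contra hc
      push Not at hc
      by_cases hr : 3 * A₂ ≤ A₁ + 1
      · -- small `A₂`: `A₃` is tiny and `A₀ ≤ N` cannot compensate
        have hsq : (3 * A₂) ^ 2 ≤ (A₁ + 1) ^ 2 := pow_le_pow_left₀ (by linarith) hr 2
        have h3 : A₁ - 16 ≤ 3 * A₃ := by linarith
        have p1 := mul_le_mul_of_nonneg_left h3 (le_of_lt hA1pos)
        linarith
      · push Not at hr
        obtain ⟨a, ha⟩ : ∃ a : ℤ, A₁ + 1 = 3 * a := ⟨(A₁ + 1) / 3, by omega⟩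
        have hta : a ≤ A₂ := by omega
        have htb : A₂ ≤ A₁ - 5 := by omega
        -- `c(t) = t³ + 3N t² − (5N−15)N t + N³ ≥ 0` at `t = A₂`
        have hc0 : 0 ≤ A₂ ^ 3 + 3 * A₁ * A₂ ^ 2 - (5 * A₁ - 15) * A₁ * A₂ + A₁ ^ 3 := by
          have k1 := mul_le_mul_of_nonneg_left hV' (mul_nonneg (le_of_lt hA1pos) hA₂)
          have k2 := mul_le_mul_of_nonneg_right hN₁ (le_of_lt hA1pos)
          have k3 := mul_le_mul_of_nonneg_right hN₂ hA₂
          linarith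
        -- `c(a) ≤ -1`, `c(N-5) ≤ -1`
        have ha7 : 7 ≤ a := by omega
        have hca : a ^ 3 + 3 * A₁ * a ^ 2 - (5 * A₁ - 15) * A₁ * a + A₁ ^ 3 ≤ -1 := by
          have hA1a : A₁ = 3 * a - 1 := by omega
          rw [hA1a]
          linarith [mul_nonneg (mul_nonneg (by linarith : (0:ℤ) ≤ a) (by linarith : (0:ℤ) ≤ a))
            (by linarith : (0:ℤ) ≤ 8 * a - 56), mul_nonneg (by linarith : (0:ℤ) ≤ a) (by linarith : (0:ℤ) ≤ a)]
        have hcb : (A₁ - 5) ^ 3 + 3 * A₁ * (A₁ - 5) ^ 2 - (5 * A₁ - 15) * A₁ * (A₁ - 5) + A₁ ^ 3 ≤ -1 := by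
          linarith
        -- chord: `(b-a) c(t) = (b-t) c(a) + (t-a) c(b) - (b-a)(t-a)(b-t)(t+3N+a+b)`
        have hP : 0 ≤ (A₂ - a) * (A₁ - 5 - A₂) * (A₂ + 3 * A₁ + a + (A₁ - 5)) :=
          mul_nonneg (mul_nonneg (sub_nonneg.2 hta) (sub_nonneg.2 htb)) (by linarith)
        have k1 := mul_le_mul_of_nonneg_left hca (sub_nonneg.2 htb)
        have k2 := mul_le_mul_of_nonneg_left hcb (sub_nonneg.2 hta)
        have k0 := mul_nonneg (by linarith : (0:ℤ) ≤ A₁ - 5 - a) hc0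
        have k4 := mul_nonneg (by linarith : (0:ℤ) ≤ A₁ - 5 - a) hP
        linarith
    -- `A₂ ≠ N - 4`, `A₂ ≠ N - 3`
    have hA2ne4 : A₂ ≠ A₁ - 4 := by
      intro hA2
      subst hA2
      have hu3 : 3 * A₃ ≤ A₁ - 7 := by
        by_contra hc
        have hc' : A₁ - 6 ≤ 3 * A₃ := by omega
        linarith [mul_le_mul_of_nonneg_left hc' (le_of_lt hA1pos)]
      have hu0 : 3 * A₀ ≤ A₁ + 5 := by
        by_contra hc
        have hc' : A₁ + 6 ≤ 3 * A₀ := by omega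
        linarith [mul_le_mul_of_nonneg_right hc' (by linarith : (0:ℤ) ≤ A₁ - 4)]
      omega
    have hA2ne3 : A₂ ≠ A₁ - 3 := by
      intro hA2
      subst hA2
      have hu3 : 3 * A₃ ≤ A₁ - 6 := by
        by_contra hc
        have hc' : A₁ - 5 ≤ 3 * A₃ := by omega
        linarith [mul_le_mul_of_nonneg_left hc' (le_of_lt hA1pos)]
      have hu0 : 3 * A₀ ≤ A₁ + 3 := by
        by_contra hc
        have hc' : A₁ + 4 ≤ 3 * A₀ := by omega
        linarith [mul_le_mul_of_nonneg_right hc' (by linarith : (0:ℤ) ≤ A₁ - 3)]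
      omega
    have hA2ge : A₁ - 2 ≤ A₂ := by omega
    -- bounds valid for `A₂ ≥ N - 2`
    have hu0 : 3 * A₀ ≤ A₁ + 2 := by
      by_contra hc
      have hc' : A₁ + 3 ≤ 3 * A₀ := by omega
      linarith [mul_le_mul hc' hA2ge (by linarith) (by linarith)]
    have hu3' : 3 * A₃ ≤ A₁ := by
      by_contra hc
      have hc' : A₁ + 1 ≤ 3 * A₃ := by omega
      linarith [mul_le_mul_of_nonneg_left hc' (le_of_lt hA1pos), pow_le_pow_left₀ hA₂ h21 2]
    refine ⟨by omega, by omega, hA2ge, Or.inl rfl, fun hA2 => ?_⟩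
    subst hA2
    have hu3 : 3 * A₃ ≤ A₁ - 4 := by
      by_contra hc
      have hc' : A₁ - 3 ≤ 3 * A₃ := by omega
      linarith [mul_le_mul_of_nonneg_left hc' (le_of_lt hA1pos)]
    omega

/-- **A-level classification, `N ≡ 2 (mod 3)`, `N` even, `N ≥ 14`.** Integers `0 ≤ Aᵢ ≤ N` with Newton's
inequalities and `3(A₀+A₁+A₂+A₃) ≥ 8N − 15` have `A₀, A₃ ≥ 1`, `A₁, A₂ ≥ N − 2`, `A₁ + A₂ ≥ 2N − 2`, and on the two
edges the pair `(3A₀, 3A₃)` is pinned. [folklore] -/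
theorem avec_mod_two (N A₀ A₁ A₂ A₃ : ℤ) (hA₀ : 0 ≤ A₀) (hA₁ : 0 ≤ A₁) (hA₂ : 0 ≤ A₂) (hA₃ : 0 ≤ A₃)
    (h₀ : A₀ ≤ N) (h₁ : A₁ ≤ N) (h₂ : A₂ ≤ N) (h₃ : A₃ ≤ N)
    (hN₁ : 3 * A₀ * A₂ ≤ A₁ ^ 2) (hN₂ : 3 * A₁ * A₃ ≤ A₂ ^ 2) (hmod : N % 3 = 2) (heven : N % 2 = 0)
    (hN : 14 ≤ N) (hV : 8 * N - 15 ≤ 3 * (A₀ + A₁ + A₂ + A₃)) :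
    1 ≤ A₀ ∧ 1 ≤ A₃ ∧ N - 2 ≤ A₁ ∧ N - 2 ≤ A₂ ∧ 2 * N - 2 ≤ A₁ + A₂ ∧
      (A₂ = N - 2 → (3 * A₀ = N - 2 ∧ 3 * A₃ = N - 5) ∨
        (3 * A₀ = N + 1 ∧ (3 * A₃ = N - 8 ∨ 3 * A₃ = N - 5))) ∧
      (A₁ = N - 2 → (3 * A₃ = N - 2 ∧ 3 * A₀ = N - 5) ∨
        (3 * A₃ = N + 1 ∧ (3 * A₀ = N - 8 ∨ 3 * A₀ = N - 5))) := by
  rcases le_total A₂ A₁ with h | h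
  · obtain ⟨q0, q3, q2, q1, qe⟩ :=
      avec_mod_two_aux N A₀ A₁ A₂ A₃ hA₀ hA₁ hA₂ hA₃ h₀ h₁ h₂ h₃ hN₁ hN₂ h hmod heven hN hV
    refine ⟨q0, q3, by omega, q2, by omega, qe, fun hA1 => by omega⟩
  · obtain ⟨q3, q0, q1, q2, qe⟩ :=
      avec_mod_two_aux N A₃ A₂ A₁ A₀ hA₃ hA₂ hA₁ hA₀ h₃ h₂ h₁ h₀ (by linarith) (by linarith) h hmod heven hN
        (by linarith)
    refine ⟨q0, q3, q1, by omega, by omega, fun hA2 => by omega, qe⟩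

/-- **The edge `(A₁, A₂) = (N, N−2)` is parity-infeasible.** If the three parts `s₁t₀u₀, s₀t₁u₀, s₀t₀u₁` of the
tiling triangle are even and sum to `N`, the other triangle sums to `N − 2`, and `(3s₀t₀u₀, 3s₁t₁u₁)` is one of
the pinned edge classes `(N−2, N−5), (N+1, N−8), (N+1, N−5)`, contradiction (parity bookkeeping mod `4`). [folklore] -/
theorem no_edge_class (N s₀ s₁ t₀ t₁ u₀ u₁ : ℕ) (hx : Even (s₁ * t₀ * u₀)) (hy : Even (s₀ * t₁ * u₀))
    (hz : Even (s₀ * t₀ * u₁)) (hN : s₁ * t₀ * u₀ + s₀ * t₁ * u₀ + s₀ * t₀ * u₁ = N)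
    (hA₂ : s₀ * t₁ * u₁ + s₁ * t₀ * u₁ + s₁ * t₁ * u₀ + 2 = N)
    (hcl : (3 * (s₀ * t₀ * u₀) + 2 = N ∧ 3 * (s₁ * t₁ * u₁) + 5 = N) ∨
      (3 * (s₀ * t₀ * u₀) = N + 1 ∧ (3 * (s₁ * t₁ * u₁) + 8 = N ∨ 3 * (s₁ * t₁ * u₁) + 5 = N))) : False := by
  have hNe : Even N := by rw [← hN]; exact (hx.add hy).add hz
  have hN2 : N % 2 = 0 := Nat.even_iff.mp hNe
  rcases hcl with ⟨h0, h3⟩ | ⟨h0, h3⟩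
  · -- class `(N-2, N-5)`: `A₃` odd, so `s₁, t₁, u₁` odd
    have hA3 : Odd (s₁ * t₁ * u₁) := Nat.odd_iff.mpr (by omega)
    obtain ⟨hst, hu1⟩ := Nat.odd_mul.mp hA3
    obtain ⟨hs1, ht1⟩ := Nat.odd_mul.mp hst
    have ns1 := Nat.not_even_iff_odd.mpr hs1
    have nt1 := Nat.not_even_iff_odd.mpr ht1
    have nu1 := Nat.not_even_iff_odd.mpr hu1
    -- parities: `x' ≡ s₀`, `y' ≡ t₀`, `z' ≡ u₀`; even parts give `t₀ ∨ u₀`, `s₀ ∨ u₀`, `s₀ ∨ t₀` even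
    have px : (s₀ * t₁ * u₁) % 2 = 0 ↔ s₀ % 2 = 0 := by
      rw [← Nat.even_iff, ← Nat.even_iff, Nat.even_mul, Nat.even_mul]; tauto
    have py : (s₁ * t₀ * u₁) % 2 = 0 ↔ t₀ % 2 = 0 := by
      rw [← Nat.even_iff, ← Nat.even_iff, Nat.even_mul, Nat.even_mul]; tauto
    have pz : (s₁ * t₁ * u₀) % 2 = 0 ↔ u₀ % 2 = 0 := by
      rw [← Nat.even_iff, ← Nat.even_iff, Nat.even_mul, Nat.even_mul]; tauto
    have ex : t₀ % 2 = 0 ∨ u₀ % 2 = 0 := by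
      rw [← Nat.even_iff, ← Nat.even_iff]; rw [Nat.even_mul, Nat.even_mul] at hx; tauto
    have ey : s₀ % 2 = 0 ∨ u₀ % 2 = 0 := by
      rw [← Nat.even_iff, ← Nat.even_iff]; rw [Nat.even_mul, Nat.even_mul] at hy; tauto
    have ez : s₀ % 2 = 0 ∨ t₀ % 2 = 0 := by
      rw [← Nat.even_iff, ← Nat.even_iff]; rw [Nat.even_mul, Nat.even_mul] at hz; tauto
    by_cases hall : s₀ % 2 = 0 ∧ t₀ % 2 = 0 ∧ u₀ % 2 = 0
    · -- all even: `N ≡ 0 (mod 4)` but `3A₀ + 2 = N` with `8 ∣ A₀`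
      obtain ⟨a, rfl⟩ : ∃ a, s₀ = 2 * a := ⟨s₀ / 2, by omega⟩
      obtain ⟨b, rfl⟩ : ∃ b, t₀ = 2 * b := ⟨t₀ / 2, by omega⟩
      obtain ⟨c, rfl⟩ : ∃ c, u₀ = 2 * c := ⟨u₀ / 2, by omega⟩
      have e1 : s₁ * (2 * b) * (2 * c) = 4 * (s₁ * b * c) := by ring
      have e2 : 2 * a * t₁ * (2 * c) = 4 * (a * t₁ * c) := by ring
      have e3 : 2 * a * (2 * b) * u₁ = 4 * (a * b * u₁) := by ring
      have e0 : 2 * a * (2 * b) * (2 * c) = 8 * (a * b * c) := by ring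
      rw [e1, e2, e3] at hN
      rw [e0] at h0
      omega
    · omega
  · -- classes `(N+1, ·)`: `A₀` odd, so `s₀, t₀, u₀` odd and `s₁, t₁, u₁` even
    have hA0 : Odd (s₀ * t₀ * u₀) := Nat.odd_iff.mpr (by omega)
    obtain ⟨hst, hu0⟩ := Nat.odd_mul.mp hA0
    obtain ⟨hs0, ht0⟩ := Nat.odd_mul.mp hst
    have ns0 := Nat.not_even_iff_odd.mpr hs0
    have nt0 := Nat.not_even_iff_odd.mpr ht0
    have nu0 := Nat.not_even_iff_odd.mpr hu0
    have hs1 : Even s₁ := by rw [Nat.even_mul, Nat.even_mul] at hx; tauto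
    have ht1 : Even t₁ := by rw [Nat.even_mul, Nat.even_mul] at hy; tauto
    have hu1 : Even u₁ := by rw [Nat.even_mul, Nat.even_mul] at hz; tauto
    obtain ⟨a, rfl⟩ := hs1.two_dvd
    obtain ⟨b, rfl⟩ := ht1.two_dvd
    obtain ⟨c, rfl⟩ := hu1.two_dvd
    have e1 : s₀ * (2 * b) * (2 * c) = 4 * (s₀ * b * c) := by ring
    have e2 : 2 * a * t₀ * (2 * c) = 4 * (a * t₀ * c) := by ring
    have e3 : 2 * a * (2 * b) * u₀ = 4 * (a * b * u₀) := by ring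
    have e4 : 2 * a * (2 * b) * (2 * c) = 8 * (a * b * c) := by ring
    rw [e1, e2, e3] at hA₂
    rw [e4] at h3
    omega

end Summit.MatrixMultiplication.OmegaCensus
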